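import Literature.IUT.LogVolume.FiniteProbability
import Literature.IUT.LogVolume.ArakelovDivisors
import Mathlib.RingTheory.Ideal.Int
import Mathlib.NumberTheory.RamificationInertia.Basic
import Mathlib.NumberTheory.RamificationInertia.Inertia
import Mathlib.Tactic.FieldSimp
import HarnessLib

/-!
# The index probability spaces of the fake adeles: places over `p` weighted by local degrees
# (Dupuy–Hilado, *The statement of Mochizuki's Corollary 3.12*, §2.5.4, §3.4, §3.6)

Dupuy–Hilado, arXiv:2004.13228 (pre-split text; Ramanujan J. **68** (2025)), §3.6 "Fake Adeles",
read on the page (corpus render `paper:arxiv-2004.13228`, chunks 9–10):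

> "Finally, in order to define random measurable sets, we need to give the index sets
> `V(F₀)^{r+1}_p` the structure of a probability space. First, the set `(V(F₀)_p, Pr : V(F₀)_p → ℝ)`
> defines a finite probability space with `Pr(v) = [F_{0,v}:ℚ_p]/[F₀:ℚ]`. Since products of
> probability spaces are probability spaces the sets `V(F₀)_p^{r+1}` also have the natural structure
> of a probability space."

and Def. 3.6.3: "`𝕃_p = ⊕_{j=1}^{(l−1)/2} 𝔸^{⊗ j+1}_{V̲,p}`, `ln ν̄_{𝕃_p}(B) = 𝔼(ln ν̄_{𝔸^{⊗ j+1}_{V̲,p}}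
(B_p^{(j+1)}) | 1 ≤ j ≤ (l−1)/2)`, … `ln ν̄_{𝔸^{⊗ j+1}_{V̲,p}}(B) = 𝔼(log μ̄_{v⃗}(B_{v⃗}) | v⃗ ∈
V(F₀)_p^{j+1})`" — i.e. Mochizuki's "procession-normalized mono-analytic log-volume" ([IUTchIII]
Prop. 3.9 (ii); [IUTchIV] Prop. 1.4) is an iterated expectation over THREE finite probability
spaces: the uniform space on `j`, the `(j+1)`-fold power of `V(F₀)_p`, and `V(F₀)_p` itself.

This file DEFINES these index spaces on Mathlib for a number field `F`: the residue characteristic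
`p_v` of a finite place (`Ideal.absNorm (v.asIdeal.under ℤ)`, a prime, with `v | p_v`), the
ramification index `e_v` and residue degree `f_v` over `p_v` (Mathlib's `Ideal.ramificationIdx'`,
`Ideal.inertiaDeg'`), the LOCAL DEGREE `n_v := e_v·f_v`, the finite set `V(F)_p` of places over a
prime `p`, and the probability weights `Pr(v) := n_v/[F:ℚ]` on `V(F)_p` — total mass one by the
fundamental identity `Σ_{v|p} e_v f_v = [F:ℚ]` (Mathlib's `Ideal.sum_ramification_inertia`). It
PROVES the two averaging identities the degree/volume conversion (Thm. 3.10.1) rests on: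
`ln|κ(v)| = f_v·ln p_v` (`logNorm_eq`), and
`𝔼(−a_v·ln|κ(v)|/n_v : v ∈ V(F)_p) = −deĝ̲(Σ_{v|p} a_v[v])` (`expect_neg_deg_div_localDegree`) — this
is the computation "`𝔼(−deĝ(ord_v(t_v)[v])/[F_{0,v}:ℚ_p]) = (−1/[F₀:ℚ]) Σ_{v|p} deĝ(ord_v(D)[v]) =
−deĝ̲(D)`" of the proof of Thm. 3.10.1 (i).

MODELLING NOTE (one place where a classical theorem is replaced by its value): Dupuy–Hilado's weight
is `[F_{0,v}:ℚ_p]`, the degree of the completion; we DEFINE the local degree as `n_v := e_v f_v`,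
which equals `[F_v:ℚ_p]` by the standard structure theorem for completions of number fields (e.g.
Neukirch, *Algebraic Number Theory* II (8.2)/(8.5)); Mathlib (pin v4.32.0) has the completions
(`adicCompletion`) but, as far as we found (`lean search`), not this degree formula, and nothing below
needs the completion itself. `TODO(general form)`: `n_v = finrank ℚ_[p] (v.adicCompletion F)`.

Deliberately NOT here: the tensor packets `K_{v_0} ⊗ ⋯ ⊗ K_{v_j}` and their Haar measures (the
carriers indexed by these spaces), archimedean places (`p = ∞`).
-/

noncomputable section

namespace Literature.IUT.LogVolume

open NumberField IsDedekindDomain Finset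

variable (F : Type*) [Field F] [NumberField F]

/-! ## Residue characteristic, ramification index, residue degree, local degree -/

/-- The residue characteristic `p_v` of the finite place `v`: the positive generator of
`v ∩ ℤ` (`|κ(v)| = p_v^{f_v}`, §2.5.4). [cite: DupuyHilado2025, §2.5.4] -/
def residueChar (v : HeightOneSpectrum (𝓞 F)) : ℕ := Ideal.absNorm (v.asIdeal.under ℤ)

omit [NumberField F] in
/-- `p_v` is a prime number. [cite: DupuyHilado2025, §2.5.4] -/
theorem residueChar_prime (v : HeightOneSpectrum (𝓞 F)) : (residueChar F v).Prime := by
  haveI : NeZero v.asIdeal := ⟨v.ne_bot⟩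
  exact Nat.absNorm_under_prime v.asIdeal

/-- `v` lies over `p_v`. [cite: DupuyHilado2025, §2.5.4] -/
instance liesOver_residueChar (v : HeightOneSpectrum (𝓞 F)) :
    v.asIdeal.LiesOver (Ideal.span {(residueChar F v : ℤ)}) :=
  Int.liesOver_span_absNorm v.asIdeal

/-- The ramification index `e_v = e(v | p_v)` (§2.4.2 "`e(L/K)` denote the ramification degree").
[cite: DupuyHilado2025, §2.4.2] -/
def ramIdx (v : HeightOneSpectrum (𝓞 F)) : ℕ :=
  Ideal.ramificationIdx' (Ideal.span {(residueChar F v : ℤ)}) v.asIdeal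

/-- The residue degree `f_v = f(v | p_v)` (`|κ(v)| = p_v^{f_v}`, §2.5.4). [cite: DupuyHilado2025, §2.5.4] -/
def resDeg (v : HeightOneSpectrum (𝓞 F)) : ℕ :=
  Ideal.inertiaDeg' (Ideal.span {(residueChar F v : ℤ)}) v.asIdeal

/-- The LOCAL DEGREE `n_v := e_v · f_v` (`= [F_v:ℚ_{p_v}]` classically — see the module docstring's
modelling note; this is the weight "`[F_{0,v}:ℚ_p]`" of §3.6). [cite: DupuyHilado2025, §3.6] -/
def localDegree (v : HeightOneSpectrum (𝓞 F)) : ℕ := ramIdx F v * resDeg F v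

/-- `|κ(v)| = p_v^{f_v}`. [cite: DupuyHilado2025, §2.5.4] -/
theorem absNorm_eq (v : HeightOneSpectrum (𝓞 F)) :
    Ideal.absNorm v.asIdeal = residueChar F v ^ resDeg F v :=
  Ideal.absNorm_eq_pow_inertiaDeg' v.asIdeal (residueChar_prime F v)

/-- `ln|κ(v)| = f_v · ln p_v`. [cite: DupuyHilado2025, §2.5.4] -/
theorem logNorm_eq (v : HeightOneSpectrum (𝓞 F)) :
    logNorm F v = resDeg F v * Real.log (residueChar F v) := by
  rw [logNorm, absNorm_eq]
  push_cast
  rw [Real.log_pow]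

/-- `e_v ≠ 0`. [cite: DupuyHilado2025, §2.4.2] -/
theorem ramIdx_ne_zero (v : HeightOneSpectrum (𝓞 F)) : ramIdx F v ≠ 0 := by
  have hp : (Ideal.span {(residueChar F v : ℤ)}) ≠ ⊥ := by
    simp [(residueChar_prime F v).ne_zero]
  exact Ideal.IsDedekindDomain.ramificationIdx'_ne_zero_of_liesOver v.asIdeal hp

/-- `f_v ≠ 0`. [cite: DupuyHilado2025, §2.5.4] -/
theorem resDeg_ne_zero (v : HeightOneSpectrum (𝓞 F)) : resDeg F v ≠ 0 := by
  haveI : Fact (residueChar F v).Prime := ⟨residueChar_prime F v⟩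
  exact Ideal.inertiaDeg'_ne_zero _ _

/-- `n_v > 0`. [cite: DupuyHilado2025, §3.6] -/
theorem localDegree_pos (v : HeightOneSpectrum (𝓞 F)) : 0 < localDegree F v :=
  Nat.pos_of_ne_zero (mul_ne_zero (ramIdx_ne_zero F v) (resDeg_ne_zero F v))

/-! ## The places over `p` and their probability weights -/

/-- `V(F)_p`: the finite set of finite places of `F` over the rational prime `p`.
[cite: DupuyHilado2025, §2.5, §3.6] -/
def placesOver (p : ℕ) : Finset (HeightOneSpectrum (𝓞 F)) :=
  (IsDedekindDomain.primesOverFinset (Ideal.span {(p : ℤ)}) (𝓞 F)).preimage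
    HeightOneSpectrum.asIdeal (fun _ _ _ _ h => HeightOneSpectrum.ext h)

variable {F}

/-- Membership in `V(F)_p` is "lies over `p`". [cite: DupuyHilado2025, §2.5, §3.6] -/
theorem mem_placesOver_iff {p : ℕ} [hp : Fact p.Prime] (v : HeightOneSpectrum (𝓞 F)) :
    v ∈ placesOver F p ↔ v.asIdeal.LiesOver (Ideal.span {(p : ℤ)}) := by
  have hpb : Ideal.span {(p : ℤ)} ≠ ⊥ := by simp [hp.out.ne_zero]
  rw [placesOver, Finset.mem_preimage, IsDedekindDomain.mem_primesOverFinset_iff hpb]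
  exact ⟨fun h => h.2, fun h => ⟨v.isPrime, h⟩⟩

/-- `v ∈ V(F)_p` iff the residue characteristic of `v` is `p`. [cite: DupuyHilado2025, §2.5.4, §3.6] -/
theorem mem_placesOver_iff_residueChar {p : ℕ} [hp : Fact p.Prime] (v : HeightOneSpectrum (𝓞 F)) :
    v ∈ placesOver F p ↔ residueChar F v = p := by
  rw [mem_placesOver_iff]
  constructor
  · intro h
    have h1 : v.asIdeal.under ℤ = Ideal.span {(p : ℤ)} := (Ideal.LiesOver.over (p := Ideal.span _)).symm
    rw [residueChar, h1, Ideal.absNorm_span_singleton]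
    simp
  · intro h
    rw [← h]
    exact liesOver_residueChar F v

/-- Every finite place lies over its residue characteristic: `v ∈ V(F)_{p_v}`.
[cite: DupuyHilado2025, §2.5.4, §3.6] -/
theorem mem_placesOver_residueChar (v : HeightOneSpectrum (𝓞 F)) :
    haveI : Fact (residueChar F v).Prime := ⟨residueChar_prime F v⟩
    v ∈ placesOver F (residueChar F v) := by
  haveI : Fact (residueChar F v).Prime := ⟨residueChar_prime F v⟩
  exact (mem_placesOver_iff_residueChar v).mpr rfl

variable (F)

/-- **The fundamental identity** `Σ_{v ∈ V(F)_p} n_v = [F:ℚ]` (Mathlib's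
`Ideal.sum_ramification_inertia`, re-indexed by places). [cite: DupuyHilado2025, §3.6] -/
theorem sum_localDegree (p : ℕ) [hp : Fact p.Prime] :
    ∑ v ∈ placesOver F p, localDegree F v = Module.finrank ℚ F := by
  have hpb : Ideal.span {(p : ℤ)} ≠ ⊥ := by simp [hp.out.ne_zero]
  have key := Ideal.sum_ramification_inertia (R := ℤ) (𝓞 F) ℚ F (p := Ideal.span {(p : ℤ)}) hpb
  have h1 : ∑ v ∈ placesOver F p, localDegree F v = ∑ v ∈ placesOver F p,
      Ideal.ramificationIdx' (Ideal.span {(p : ℤ)}) v.asIdeal *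
        Ideal.inertiaDeg' (Ideal.span {(p : ℤ)}) v.asIdeal := by
    refine Finset.sum_congr rfl fun v hv => ?_
    rw [mem_placesOver_iff_residueChar] at hv
    simp only [localDegree, ramIdx, resDeg, hv]
  rw [h1, ← key]
  refine Finset.sum_preimage HeightOneSpectrum.asIdeal
    (IsDedekindDomain.primesOverFinset (Ideal.span {(p : ℤ)}) (𝓞 F)) _
    (fun P => Ideal.ramificationIdx' (Ideal.span {(p : ℤ)}) P *
      Ideal.inertiaDeg' (Ideal.span {(p : ℤ)}) P) ?_
  intro P hP hnot
  exfalso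
  rw [IsDedekindDomain.mem_primesOverFinset_iff hpb] at hP
  exact hnot ⟨⟨P, hP.1, Ideal.ne_bot_of_mem_primesOver hpb hP⟩, rfl⟩

/-- `V(F)_p` is non-empty. [cite: DupuyHilado2025, §3.6] -/
theorem placesOver_nonempty (p : ℕ) [Fact p.Prime] : (placesOver F p).Nonempty := by
  by_contra h
  rw [Finset.not_nonempty_iff_eq_empty] at h
  have := sum_localDegree F p
  rw [h, Finset.sum_empty] at this
  exact absurd this.symm (Module.finrank_pos).ne'

/-- The weight `Pr(v) = n_v/[F:ℚ]` of a finite place ("`Pr(v) = [F_{0,v}:ℚ_p]/[F₀:ℚ]`"), as a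
function of the place alone. [cite: DupuyHilado2025, §3.6] -/
def weight (v : HeightOneSpectrum (𝓞 F)) : ℝ := (localDegree F v : ℝ) / Module.finrank ℚ F

/-- `Pr(v) ≥ 0`. [cite: DupuyHilado2025, §3.6] -/
theorem weight_nonneg (v : HeightOneSpectrum (𝓞 F)) : 0 ≤ weight F v := by
  unfold weight; positivity

/-- **The probability space `(V(F)_p, Pr)`**, `Pr(v) = n_v/[F:ℚ]` ("`Pr(v) = [F_{0,v}:ℚ_p]/[F₀:ℚ]`").
[cite: DupuyHilado2025, §3.6] -/
def localWeights (p : ℕ) [Fact p.Prime] : ProbWeights (placesOver F p) where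
  pr v := weight F v.1
  pr_nonneg v := weight_nonneg F v.1
  sum_pr := by
    simp only [weight]
    rw [← Finset.sum_div, Finset.sum_coe_sort (placesOver F p) (fun v => (localDegree F v : ℝ))]
    have h := sum_localDegree F p
    have hF : (Module.finrank ℚ F : ℝ) ≠ 0 := by exact_mod_cast (Module.finrank_pos).ne'
    rw [div_eq_one_iff_eq hF]
    exact_mod_cast h

/-- The weights, unfolded. [cite: DupuyHilado2025, §3.6] -/
theorem localWeights_pr (p : ℕ) [Fact p.Prime] (v : placesOver F p) :
    (localWeights F p).pr v = (localDegree F v.1 : ℝ) / Module.finrank ℚ F := rfl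

/-- `Pr(v)/n_v = 1/[F:ℚ]` — the cancellation behind "this is exactly the reason we defined `ln ν̄` in
this "fake adelic" way" (proof of Thm. 3.10.1). [cite: DupuyHilado2025, §3.6, Thm. 3.10.1 proof] -/
theorem localWeights_pr_div_localDegree (p : ℕ) [Fact p.Prime] (v : placesOver F p) :
    (localWeights F p).pr v / localDegree F v.1 = 1 / Module.finrank ℚ F := by
  have hn : (localDegree F v.1 : ℝ) ≠ 0 := by exact_mod_cast (localDegree_pos F v.1).ne'
  rw [localWeights_pr]
  field_simp

/-- **Averaging identity** (proof of Thm. 3.10.1 (i)): for coefficients `a_v`,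
`𝔼(−a_v·ln|κ(v)|/n_v : v ∈ V(F)_p) = −deĝ̲(Σ_{v ∈ V(F)_p} a_v [v])` — "`𝔼(−deĝ(ord_v(t_v)[v])/
[F_{0,v}:ℚ_p]) = (−1/[F₀:ℚ]) Σ_{v|p} deĝ(ord_v(D)[v]) = −deĝ̲(D)`".
[cite: DupuyHilado2025, Thm. 3.10.1 proof] -/
theorem expect_neg_deg_div_localDegree (p : ℕ) [Fact p.Prime] (a : HeightOneSpectrum (𝓞 F) → ℝ) :
    (localWeights F p).expect (fun v => -(a v.1 * logNorm F v.1) / localDegree F v.1) =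
      -FinDivisor.ndeg F (∑ v ∈ placesOver F p, FinDivisor.of v (a v)) := by
  rw [FinDivisor.ndeg_apply, FinDivisor.deg_sum_of, ProbWeights.expect]
  have hF : (Module.finrank ℚ F : ℝ) ≠ 0 := by exact_mod_cast (Module.finrank_pos).ne'
  have step : ∀ v : placesOver F p,
      -(a v.1 * logNorm F v.1) / localDegree F v.1 * (localWeights F p).pr v =
        -(a v.1 * logNorm F v.1) / Module.finrank ℚ F := by
    intro v
    have hn : (localDegree F v.1 : ℝ) ≠ 0 := by exact_mod_cast (localDegree_pos F v.1).ne'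
    rw [localWeights_pr]
    field_simp
  simp_rw [step]
  rw [← Finset.sum_div, Finset.sum_coe_sort (placesOver F p) (fun v => -(a v * logNorm F v)),
    Finset.sum_neg_distrib, neg_div]

/-- The same averaging identity for coefficients given on `V(F)_p` as a type:
`𝔼(−a_v·ln|κ(v)|/n_v) = −deĝ̲(Σ_{v : V(F)_p} a_v [v])`. [cite: DupuyHilado2025, Thm. 3.10.1 proof] -/
theorem expect_neg_deg_div_localDegree' (p : ℕ) [Fact p.Prime] (a : placesOver F p → ℝ) :
    (localWeights F p).expect (fun v => -(a v * logNorm F v.1) / localDegree F v.1) =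
      -FinDivisor.ndeg F (∑ v : placesOver F p, FinDivisor.of v.1 (a v)) := by
  rw [FinDivisor.ndeg_apply, map_sum, ProbWeights.expect]
  simp only [FinDivisor.deg_of]
  have step : ∀ v : placesOver F p,
      -(a v * logNorm F v.1) / localDegree F v.1 * (localWeights F p).pr v =
        -(a v * logNorm F v.1) / Module.finrank ℚ F := by
    intro v
    have hn : (localDegree F v.1 : ℝ) ≠ 0 := by exact_mod_cast (localDegree_pos F v.1).ne'
    rw [localWeights_pr]
    field_simp
  simp_rw [step]
  rw [← Finset.sum_div, Finset.sum_neg_distrib, neg_div]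

/-! ## Tuples of places and the procession index -/

/-- The probability space of `(j+1)`-TUPLES `V(F)_p^{j+1}` (independent power), indexing the direct
summands `K_{v_0} ⊗ ⋯ ⊗ K_{v_j}` of the tensor power `𝔸^{⊗ j+1}_{V̲,p}` (Def. 3.6.1, §3.6).
[cite: DupuyHilado2025, Def. 3.6.1, §3.6] -/
def tupleWeights (p : ℕ) [Fact p.Prime] (j : ℕ) : ProbWeights (Fin (j + 1) → placesOver F p) :=
  (localWeights F p).pi (j + 1)

/-- The expectation over tuples of a quantity depending on ONE coordinate is the expectation over
places — "`𝔼(ln|t_{v_{r−1}}|_p : (v_0,…,v_{r−1}) ∈ V(F₀)_p^r) = 𝔼(ln|t_v|_p : v ∈ V(F₀)_p)`"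
(proof of Thm. 3.10.1 (i), tensor-power case). [cite: DupuyHilado2025, Thm. 3.10.1 proof] -/
theorem tupleWeights_expect_coord (p : ℕ) [Fact p.Prime] (j : ℕ) (i : Fin (j + 1))
    (f : placesOver F p → ℝ) :
    (tupleWeights F p j).expect (fun e => f (e i)) = (localWeights F p).expect f :=
  (localWeights F p).expect_pi_coord j i f

/-- The PROCESSION index space: uniform on `j ∈ {1, …, ℓ⋇}` (`ℓ⋇ = (l−1)/2 ≥ 1`; index `i : Fin ℓ⋇`
stands for `j = i+1`) — "`𝔼( … | 1 ≤ j ≤ (l−1)/2)`" of Def. 3.6.3, the lgp-average of Def. 3.1.1.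
[cite: DupuyHilado2025, Def. 3.6.3] -/
def processionWeights (lstar : ℕ) [NeZero lstar] : ProbWeights (Fin lstar) :=
  ProbWeights.uniform (Fin lstar)

/-- Its expectation is the uniform average `(1/ℓ⋇) Σ_j`. [cite: DupuyHilado2025, Def. 3.6.3] -/
theorem processionWeights_expect (lstar : ℕ) [NeZero lstar] (f : Fin lstar → ℝ) :
    (processionWeights lstar).expect f = (1 / (lstar : ℝ)) * ∑ i, f i := by
  rw [processionWeights, ProbWeights.expect_uniform, Fintype.card_fin]

end Literature.IUT.LogVolume

end
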